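import Literature.NumberTheory.LFunctions.RudnickSarnakNCluster
import Literature.NumberTheory.LFunctions.RudnickSarnakLocal
import Mathlib.Analysis.MeanInequalitiesPow
import HarnessLib

/-!
# Rudnick–Sarnak `n`-level correlations for `ζ`: moments of the local zero counts

Sibling file of `Literature/NumberTheory/LFunctions/RudnickSarnak.lean` (toward
`Literature.NumberTheory.LFunctions.rudnick_sarnak_unrestricted`, Rudnick–Sarnak 1996, Theorem 3.2
for `ζ`, at every level; back end). From the clustering bound of `RudnickSarnakNCluster.lean`
(`#{γ_0 ≤ T, |γ_i − γ_0| ≤ 2πy/L} ≤ C y^k T L`, `L = log T`, for `2πy ≤ 3L`) and the unit-window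
bound `N(u + 4) − N(u − 1) ≪ log T` (Riemann–von Mangoldt) we derive the averaged estimates on
which the unsmoothing and the renormalisation rest (Rudnick–Sarnak 1996, pp. 303–304: the sums
"`Σ_{γ} … (L|γ_1 − γ_2|) ψ'(…)`" are `O(TL)`):

* `RudnickSarnakN.Unsmooth.sum_piFinset_cons` — `Σ_{m ∈ s × t^k} f(m) = Σ_{a ∈ s} Σ_{u ∈ t^k} f(a, u)`
  (bookkeeping for sums over boxes of index tuples);
* `RudnickSarnakN.Unsmooth.winCount T y a = #{n < N(T+3) : |γ_n − γ_a| ≤ 2πy/L}` and the fibre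
  identity `#clusterSet = Σ_{γ_a ≤ T} winCount^k` (`RudnickSarnakN.Unsmooth.card_clusterSet_eq`);
* `RudnickSarnakN.Unsmooth.exists_sum_winCount_pow_le` — **the moment bound**
  `Σ_{a < N(T)} winCount(T, y, a)^k ≤ C y^k T L` for *all* `y ≥ 1` and `T ≥ T₀`;
* `RudnickSarnakN.Unsmooth.exists_sum_locSum_pow_le` — **the key lemma**
  `Σ_{a < N(T)} (Σ_{n < N(T+3)} (1 + L|γ_n − γ_a|/2π)^{-3})^k ≤ C T L` (dyadic-free shell
  decomposition `⌊L|γ_n − γ_a|/2π⌋ = j` and Jensen's inequality for `x ↦ x^k` with the weights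
  `(1+j)^{-2}`, `Σ_j (1+j)^{-2} ≤ 3`).

## References

* Z. Rudnick, P. Sarnak, *Zeros of principal `L`-functions and random matrix theory*, Duke Math.
  J. 81 (1996), 269–322, pp. 302–304.
* E. C. Titchmarsh, *The Theory of the Riemann Zeta-Function* (1986), Thms. 9.2, 9.4.
-/

noncomputable section

open Complex Filter Set MeasureTheory Finset
open scoped Real Topology

namespace Literature.NumberTheory.LFunctions

namespace RudnickSarnakN

namespace Unsmooth

variable {k : ℕ}

/-! ## Sums over boxes of tuples -/

/-- **Peeling off the first coordinate of a box sum**: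
`Σ_{m ∈ Π_j (cons s t)_j} f(m) = Σ_{a ∈ s} Σ_{u ∈ Π_i t_i} f(cons a u)`. [folklore] -/
theorem sum_piFinset_cons {M : Type*} [AddCommMonoid M] (s : Finset ℕ) (t : Fin k → Finset ℕ)
    (f : (Fin (k + 1) → ℕ) → M) :
    ∑ m ∈ Fintype.piFinset (Fin.cons s t : Fin (k + 1) → Finset ℕ), f m =
      ∑ a ∈ s, ∑ u ∈ Fintype.piFinset t, f (Fin.cons a u) := by
  rw [← Finset.sum_product']
  refine Finset.sum_nbij' (fun m ↦ (m 0, Fin.tail m)) (fun p ↦ Fin.cons p.1 p.2) ?_ ?_ ?_ ?_ ?_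
  · intro m hm
    rw [Fintype.mem_piFinset] at hm
    rw [Finset.mem_product, Fintype.mem_piFinset]
    refine ⟨by simpa using hm 0, fun i ↦ ?_⟩
    exact hm i.succ
  · rintro ⟨a, u⟩ hp
    rw [Finset.mem_product, Fintype.mem_piFinset] at hp
    rw [Fintype.mem_piFinset]
    intro j
    refine Fin.cases ?_ (fun i ↦ ?_) j
    · simpa using hp.1
    · simpa using hp.2 i
  · intro m _
    simp
  · rintro ⟨a, u⟩ _
    simp
  · intro m _
    simp

/-- Box sums of products factor: `Σ_{u ∈ Π_i t_i} Π_i g_i(u_i) = Π_i Σ_{n ∈ t_i} g_i(n)`. [folklore] -/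
theorem sum_piFinset_prod (t : Fin k → Finset ℕ) (g : Fin k → ℕ → ℝ) :
    ∑ u ∈ Fintype.piFinset t, ∏ i, g i (u i) = ∏ i, ∑ n ∈ t i, g i n :=
  (Finset.prod_univ_sum t g).symm

/-! ## Window counts and the fibre identity -/

/-- The window count `n_y(a) = #{n < N(T+3) : |γ_n − γ_a| ≤ 2πy/log T}`. [cite: RudnickSarnak1996, p. 303] -/
def winCount (T y : ℝ) (a : ℕ) : ℕ :=
  ((Finset.range (zetaZeroCount (T + 3))).filter
    (fun n ↦ |zetaOrdinate n - zetaOrdinate a| ≤ 2 * π * y / Real.log T)).card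

/-- **The fibre identity**: `#clusterSet k T y = Σ_{a < N(T+3), γ_a ≤ T} winCount(T, y, a)^k`.
[folklore] -/
theorem card_clusterSet_eq (k : ℕ) (T y : ℝ) :
    ((clusterSet k T y).card : ℝ) =
      ∑ a ∈ (Finset.range (zetaZeroCount (T + 3))).filter (fun a ↦ zetaOrdinate a ≤ T),
        (winCount T y a : ℝ) ^ k := by
  classical
  set R := Finset.range (zetaZeroCount (T + 3))
  set w := 2 * π * y / Real.log T
  have h1 : ((clusterSet k T y).card : ℝ) = ∑ m ∈ Fintype.piFinset (fun _ : Fin (k + 1) ↦ R),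
      (if zetaOrdinate (m 0) ≤ T ∧ ∀ i : Fin k, |zetaOrdinate (m i.succ) - zetaOrdinate (m 0)| ≤ w
        then (1 : ℝ) else 0) := by
    unfold clusterSet
    rw [Finset.sum_boole]
  rw [h1]
  have hcons : (fun _ : Fin (k + 1) ↦ R) = (Fin.cons R (fun _ : Fin k ↦ R) : Fin (k + 1) → Finset ℕ) := by
    funext j; refine Fin.cases (by simp) (fun i ↦ by simp) j
  rw [hcons, sum_piFinset_cons, Finset.sum_filter]
  refine Finset.sum_congr rfl fun a _ ↦ ?_
  by_cases ha : zetaOrdinate a ≤ T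
  · simp only [Fin.cons_zero, Fin.cons_succ, ha, true_and, if_true]
    have : ∀ u : Fin k → ℕ, (if ∀ i : Fin k, |zetaOrdinate (u i) - zetaOrdinate a| ≤ w then (1 : ℝ) else 0) =
        ∏ i : Fin k, (if |zetaOrdinate (u i) - zetaOrdinate a| ≤ w then (1 : ℝ) else 0) := by
      intro u; rw [Finset.prod_boole]; simp
    simp_rw [this]
    rw [sum_piFinset_prod (fun _ : Fin k ↦ R) (fun _ n ↦ if |zetaOrdinate n - zetaOrdinate a| ≤ w then (1 : ℝ) else 0)]
    rw [Finset.prod_const, Finset.card_univ, Fintype.card_fin]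
    congr 1
    unfold winCount
    rw [Finset.sum_boole]
  · simp only [Fin.cons_zero, ha, false_and, if_false, Finset.sum_const_zero]

/-- The base of the fibration is `range N(T)` (`a < N(T) ↔ γ_a ≤ T`,
`riemann_von_mangoldt.zetaOrdinate_le_iff`). [cite: Titchmarsh1986, §9.1] -/
theorem filter_range_eq (T : ℝ) :
    (Finset.range (zetaZeroCount (T + 3))).filter (fun a ↦ zetaOrdinate a ≤ T) = Finset.range (zetaZeroCount T) := by
  have hiff : ∀ {a : ℕ} {T' : ℝ}, a < zetaZeroCount T' ↔ zetaOrdinate a ≤ T' := by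
    intro a T'; rw [riemann_von_mangoldt_holds.zetaOrdinate_le_iff]; omega
  ext a
  simp only [Finset.mem_filter, Finset.mem_range]
  constructor
  · rintro ⟨-, h⟩; exact hiff.2 h
  · intro h
    exact ⟨h.trans_le (zetaZeroCount_mono (by linarith)), hiff.1 h⟩

/-- **Moments at small scales** (`2πy ≤ 3 log T`): `Σ_{a < N(T)} winCount^k ≤ C y^k T L`
(the cluster bound read through the fibre identity). [cite: RudnickSarnak1996, p. 303] -/
theorem exists_sum_winCount_pow_le_small (hRH : RiemannHypothesis) (k : ℕ) :
    ∃ C : ℝ, 0 < C ∧ ∀ T : ℝ, 3 ≤ T → ∀ y : ℝ, 1 ≤ y → 2 * π * y ≤ 3 * Real.log T →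
      ∑ a ∈ Finset.range (zetaZeroCount T), (winCount T y a : ℝ) ^ k ≤ C * y ^ k * T * Real.log T := by
  obtain ⟨C, hC, h⟩ := exists_card_clusterSet_le hRH k
  refine ⟨C, hC, fun T hT y hy hyL ↦ ?_⟩
  rw [← filter_range_eq, ← card_clusterSet_eq]
  exact h T hT y hy hyL

/-! ## Unit windows and moments at large scales -/

/-- A window `[γ_a − w, γ_a + w]` is covered by `⌊2w⌋ + 1` unit windows. [folklore] -/
theorem card_filter_abs_sub_le_le {R : Finset ℕ} {B w : ℝ} (hw : 0 ≤ w)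
    (hunit : ∀ b : ℝ, ((R.filter fun n ↦ b ≤ zetaOrdinate n ∧ zetaOrdinate n ≤ b + 1).card : ℝ) ≤ B)
    (hB : 0 ≤ B) (a : ℕ) :
    ((R.filter fun n ↦ |zetaOrdinate n - zetaOrdinate a| ≤ w).card : ℝ) ≤ (2 * w + 1) * B := by
  classical
  set J : ℕ := ⌊2 * w⌋₊ + 1
  set b0 : ℝ := zetaOrdinate a - w
  have hsub : (R.filter fun n ↦ |zetaOrdinate n - zetaOrdinate a| ≤ w) ⊆
      (Finset.range J).biUnion fun j ↦ R.filter fun n ↦ b0 + j ≤ zetaOrdinate n ∧ zetaOrdinate n ≤ b0 + j + 1 := by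
    intro n hn
    rw [Finset.mem_filter] at hn
    obtain ⟨hnR, hna⟩ := hn
    rw [abs_le] at hna
    rw [Finset.mem_biUnion]
    set j : ℕ := ⌊zetaOrdinate n - b0⌋₊
    have hx0 : 0 ≤ zetaOrdinate n - b0 := by simp only [b0]; linarith
    refine ⟨j, ?_, ?_⟩
    · rw [Finset.mem_range]
      have : j ≤ ⌊2 * w⌋₊ := Nat.floor_le_floor (by simp only [b0]; linarith)
      omega
    · rw [Finset.mem_filter]
      refine ⟨hnR, ?_, ?_⟩
      · have := Nat.floor_le hx0; linarith
      · have := Nat.lt_floor_add_one (zetaOrdinate n - b0); linarith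
  calc (((R.filter fun n ↦ |zetaOrdinate n - zetaOrdinate a| ≤ w).card : ℕ) : ℝ)
      ≤ (((Finset.range J).biUnion fun j ↦ R.filter fun n ↦
          b0 + j ≤ zetaOrdinate n ∧ zetaOrdinate n ≤ b0 + j + 1).card : ℝ) := by
        exact_mod_cast Finset.card_le_card hsub
    _ ≤ ∑ j ∈ Finset.range J, ((R.filter fun n ↦ b0 + j ≤ zetaOrdinate n ∧ zetaOrdinate n ≤ b0 + j + 1).card : ℝ) := by
        exact_mod_cast Finset.card_biUnion_le
    _ ≤ ∑ _j ∈ Finset.range J, B := Finset.sum_le_sum fun j _ ↦ hunit _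
    _ = J * B := by rw [Finset.sum_const, Finset.card_range, nsmul_eq_mul]
    _ ≤ (2 * w + 1) * B := by
        refine mul_le_mul_of_nonneg_right ?_ hB
        simp only [J]; push_cast
        linarith [Nat.floor_le (by positivity : 0 ≤ 2 * w)]

/-- **Unit windows below `T + 3`**: there are `C₁ > 0` and `T₁` such that for `T ≥ T₁` every unit
window contains at most `C₁ log T` indices `n < N(T + 3)`. [cite: Titchmarsh1986, Thm. 9.2] -/
theorem exists_unitWindow_le :
    ∃ C₁ : ℝ, 0 < C₁ ∧ ∃ T₁ : ℝ, ∀ T : ℝ, T₁ ≤ T → ∀ b : ℝ,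
      (((Finset.range (zetaZeroCount (T + 3))).filter fun n ↦
          b ≤ zetaOrdinate n ∧ zetaOrdinate n ≤ b + 1).card : ℝ) ≤ C₁ * Real.log T := by
  obtain ⟨C₁, hC₁, hev⟩ := RudnickSarnak.eventually_card_filter_zetaOrdinate_window_le
  obtain ⟨T₀, hT₀⟩ := eventually_atTop.1 hev
  refine ⟨2 * C₁, by positivity, max T₀ 3, fun T hT b ↦ ?_⟩
  have hT3 : (3 : ℝ) ≤ T := le_trans (le_max_right _ _) hT
  have h := hT₀ (T + 3) (by linarith [le_max_left T₀ 3]) b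
  refine h.trans ?_
  have hlog : Real.log (T + 3) ≤ 2 * Real.log T := by
    have h1 : Real.log (T + 3) ≤ Real.log (T * T) := Real.log_le_log (by linarith) (by nlinarith)
    rw [Real.log_mul (by linarith) (by linarith)] at h1
    linarith
  nlinarith

/-- **Moments at large scales** (`3 log T ≤ 2πy`): pointwise `winCount ≤ 30 C₁ y`, hence
`Σ_{a < N(T)} winCount^k ≤ N(T) (30 C₁ y)^k ≤ C y^k T L`. [cite: Titchmarsh1986, Thm. 9.2] -/
theorem exists_sum_winCount_pow_le_large (k : ℕ) :
    ∃ C : ℝ, 0 < C ∧ ∃ T₀ : ℝ, ∀ T : ℝ, T₀ ≤ T → ∀ y : ℝ, 1 ≤ y → 3 * Real.log T ≤ 2 * π * y →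
      ∑ a ∈ Finset.range (zetaZeroCount T), (winCount T y a : ℝ) ^ k ≤ C * y ^ k * T * Real.log T := by
  obtain ⟨C₁, hC₁, T₁, hwin⟩ := exists_unitWindow_le
  obtain ⟨C₂, hC₂, hN⟩ := riemann_von_mangoldt_holds.eventually_le_mul
  obtain ⟨T₂, hT₂⟩ := eventually_atTop.1 hN
  refine ⟨C₂ * (30 * C₁) ^ k, by positivity, max (max T₁ T₂) 3, fun T hT y hy hyL ↦ ?_⟩
  have hT1 : T₁ ≤ T := le_trans (le_trans (le_max_left _ _) (le_max_left _ _)) hT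
  have hT2 : T₂ ≤ T := le_trans (le_trans (le_max_right _ _) (le_max_left _ _)) hT
  have hT3 : (3 : ℝ) ≤ T := le_trans (le_max_right _ _) hT
  have hL : 1 ≤ Real.log T := by
    rw [Real.le_log_iff_exp_le (by linarith)]
    exact le_trans (le_of_lt (lt_trans Real.exp_one_lt_d9 (by norm_num))) hT3
  have hL0 : 0 < Real.log T := by linarith
  set w : ℝ := 2 * π * y / Real.log T
  have hw0 : 0 ≤ w := by positivity
  -- pointwise bound
  have hpt : ∀ a, (winCount T y a : ℝ) ≤ 30 * C₁ * y := by
    intro a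
    have h := card_filter_abs_sub_le_le (R := Finset.range (zetaZeroCount (T + 3))) hw0 (hwin T hT1)
      (by positivity) a
    refine le_trans h ?_
    -- `2w + 1 ≤ (14π/3) y / L` and `C₁ L (14π/3)(y/L) ≤ 30 C₁ y`
    have h1 : (1 : ℝ) ≤ 2 * π * y / (3 * Real.log T) := by
      rw [le_div_iff₀ (by positivity)]; linarith
    have h2 : 2 * w + 1 ≤ 2 * w + 2 * π * y / (3 * Real.log T) := by linarith
    calc (2 * w + 1) * (C₁ * Real.log T) ≤ (2 * w + 2 * π * y / (3 * Real.log T)) * (C₁ * Real.log T) :=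
          mul_le_mul_of_nonneg_right h2 (by positivity)
      _ = (4 * π + 2 * π / 3) * C₁ * y := by simp only [w]; field_simp; ring
      _ ≤ 30 * C₁ * y := by
          have : 4 * π + 2 * π / 3 ≤ 30 := by nlinarith [Real.pi_lt_d2]
          have h0 : 0 ≤ C₁ * y := by positivity
          nlinarith
  -- sum
  have hNT := hT₂ T hT2
  calc ∑ a ∈ Finset.range (zetaZeroCount T), (winCount T y a : ℝ) ^ k
      ≤ ∑ _a ∈ Finset.range (zetaZeroCount T), (30 * C₁ * y) ^ k :=
        Finset.sum_le_sum fun a _ ↦ pow_le_pow_left₀ (Nat.cast_nonneg _) (hpt a) _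
    _ = zetaZeroCount T * (30 * C₁ * y) ^ k := by rw [Finset.sum_const, Finset.card_range, nsmul_eq_mul]
    _ ≤ C₂ * (T * Real.log T) * (30 * C₁ * y) ^ k := mul_le_mul_of_nonneg_right hNT (by positivity)
    _ = C₂ * (30 * C₁) ^ k * y ^ k * T * Real.log T := by rw [mul_pow]; ring

/-- **The moment bound** (all scales): there are `C > 0` and `T₀` such that for all `T ≥ T₀`
and all `y ≥ 1`, `Σ_{a < N(T)} winCount(T, y, a)^k ≤ C y^k T log T` (RH).
[cite: RudnickSarnak1996, p. 303] -/
theorem exists_sum_winCount_pow_le (hRH : RiemannHypothesis) (k : ℕ) :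
    ∃ C : ℝ, 0 < C ∧ ∃ T₀ : ℝ, 3 ≤ T₀ ∧ ∀ T : ℝ, T₀ ≤ T → ∀ y : ℝ, 1 ≤ y →
      ∑ a ∈ Finset.range (zetaZeroCount T), (winCount T y a : ℝ) ^ k ≤ C * y ^ k * T * Real.log T := by
  obtain ⟨C₁, hC₁, h₁⟩ := exists_sum_winCount_pow_le_small hRH k
  obtain ⟨C₂, hC₂, T₀, h₂⟩ := exists_sum_winCount_pow_le_large k
  refine ⟨max C₁ C₂, lt_max_of_lt_left hC₁, max T₀ 3, le_max_right _ _, fun T hT y hy ↦ ?_⟩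
  have hT3 : (3 : ℝ) ≤ T := le_trans (le_max_right _ _) hT
  have hT0 : T₀ ≤ T := le_trans (le_max_left _ _) hT
  have hL : 0 ≤ Real.log T := Real.log_nonneg (by linarith)
  have hmono : ∀ {C : ℝ}, C ≤ max C₁ C₂ → C * y ^ k * T * Real.log T ≤ max C₁ C₂ * y ^ k * T * Real.log T :=
    fun hC ↦ by gcongr
  rcases le_or_gt (2 * π * y) (3 * Real.log T) with h | h
  · exact (h₁ T hT3 y hy h).trans (hmono (le_max_left _ _))
  · exact (h₂ T hT0 y hy h.le).trans (hmono (le_max_right _ _))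

/-! ## The key lemma: moments of the smoothed local counts -/

/-- The smoothed local count `G(a) = Σ_{n < N(T+3)} (1 + L|γ_n − γ_a|/2π)^{-3}`.
[cite: RudnickSarnak1996, p. 303] -/
def locSum (T : ℝ) (a : ℕ) : ℝ :=
  ∑ n ∈ Finset.range (zetaZeroCount (T + 3)),
    ((1 + Real.log T * |zetaOrdinate n - zetaOrdinate a| / (2 * π)) ^ 3)⁻¹

/-- `G(a) ≥ 0`. [folklore] -/
theorem locSum_nonneg {T : ℝ} (hL : 0 ≤ Real.log T) (a : ℕ) : 0 ≤ locSum T a :=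
  Finset.sum_nonneg fun n _ ↦ by positivity

/-- `Σ_{j < B} (1+j)^{-2} ≤ 3`. [folklore] -/
theorem sum_range_inv_succ_sq_le (B : ℕ) : ∑ j ∈ Finset.range B, (((j : ℝ) + 1) ^ 2)⁻¹ ≤ 3 :=
  RudnickSarnak.sum_inv_succ_sq_le_three _

/-- **The shell bound**: `G(a) ≤ Σ_{j < B} (1+j)^{-3} winCount(T, j+1, a)` whenever every
normalised distance `L|γ_n − γ_a|/2π` (`n < N(T+3)`) is `< B`. [folklore] -/
theorem locSum_le_sum_shells {T : ℝ} (hL : 0 < Real.log T) (a : ℕ) {B : ℕ}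
    (hB : ∀ n ∈ Finset.range (zetaZeroCount (T + 3)),
      Real.log T * |zetaOrdinate n - zetaOrdinate a| / (2 * π) < B) :
    locSum T a ≤ ∑ j ∈ Finset.range B, (((j : ℝ) + 1) ^ 3)⁻¹ * (winCount T (j + 1) a : ℝ) := by
  classical
  set R := Finset.range (zetaZeroCount (T + 3))
  set d : ℕ → ℝ := fun n ↦ Real.log T * |zetaOrdinate n - zetaOrdinate a| / (2 * π)
  have hd0 : ∀ n, 0 ≤ d n := fun n ↦ by positivity
  set sh : ℕ → ℕ := fun n ↦ ⌊d n⌋₊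
  have hmaps : ∀ n ∈ R, sh n ∈ Finset.range B := by
    intro n hn
    rw [Finset.mem_range]
    have h1 : (sh n : ℝ) ≤ d n := Nat.floor_le (hd0 n)
    have h2 := hB n hn
    exact_mod_cast h1.trans_lt h2
  -- pointwise: `(1 + d n)^{-3} ≤ (1 + sh n)^{-3}`
  have hpt : ∀ n ∈ R, ((1 + d n) ^ 3)⁻¹ ≤ ((((sh n : ℕ) : ℝ) + 1) ^ 3)⁻¹ := by
    intro n _
    have h1 : ((sh n : ℕ) : ℝ) ≤ d n := Nat.floor_le (hd0 n)
    have h0 : (0 : ℝ) < ((sh n : ℕ) : ℝ) + 1 := by positivity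
    exact inv_anti₀ (pow_pos h0 3) (pow_le_pow_left₀ h0.le (by linarith) 3)
  calc locSum T a = ∑ n ∈ R, ((1 + d n) ^ 3)⁻¹ := rfl
    _ ≤ ∑ n ∈ R, ((((sh n : ℕ) : ℝ) + 1) ^ 3)⁻¹ := Finset.sum_le_sum hpt
    _ = ∑ j ∈ Finset.range B, ∑ n ∈ R with sh n = j, (((j : ℝ) + 1) ^ 3)⁻¹ :=
        (Finset.sum_fiberwise_of_maps_to' hmaps (fun j ↦ (((j : ℝ) + 1) ^ 3)⁻¹)).symm
    _ = ∑ j ∈ Finset.range B, (((j : ℝ) + 1) ^ 3)⁻¹ * ((R.filter fun n ↦ sh n = j).card : ℝ) := by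
        refine Finset.sum_congr rfl fun j _ ↦ ?_
        rw [Finset.sum_const, nsmul_eq_mul, mul_comm]
    _ ≤ ∑ j ∈ Finset.range B, (((j : ℝ) + 1) ^ 3)⁻¹ * (winCount T (j + 1) a : ℝ) := by
        refine Finset.sum_le_sum fun j _ ↦ mul_le_mul_of_nonneg_left ?_ (by positivity)
        unfold winCount
        exact_mod_cast Finset.card_le_card fun n hn ↦ by
          rw [Finset.mem_filter] at hn ⊢
          refine ⟨hn.1, ?_⟩
          -- `d n < sh n + 1 = j + 1`
          have hlt : d n < (sh n : ℝ) + 1 := Nat.lt_floor_add_one _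
          rw [hn.2] at hlt
          rw [le_div_iff₀ hL]
          have : d n * (2 * π) = Real.log T * |zetaOrdinate n - zetaOrdinate a| := by
            simp only [d]; field_simp
          have h2 : 2 * π * d n < 2 * π * ((j : ℝ) + 1) := mul_lt_mul_of_pos_left hlt (by positivity)
          push_cast
          nlinarith [h2, this]

/-- **Jensen step**: for non-negative `u_j` and the weights `v_j = (1+j)^{-2}` (`Σ v_j ≤ 3`,
`v_0 = 1`), `(Σ_{j<B} v_j u_j)^k ≤ 3^k Σ_{j<B} v_j u_j^k` (`B ≥ 1`). [folklore] -/
theorem pow_sum_weights_le {B : ℕ} (hB : 0 < B) (u : ℕ → ℝ) (hu : ∀ j, 0 ≤ u j) (k : ℕ) :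
    (∑ j ∈ Finset.range B, (((j : ℝ) + 1) ^ 2)⁻¹ * u j) ^ k ≤
      3 ^ k * ∑ j ∈ Finset.range B, (((j : ℝ) + 1) ^ 2)⁻¹ * u j ^ k := by
  set v : ℕ → ℝ := fun j ↦ (((j : ℝ) + 1) ^ 2)⁻¹
  set V : ℝ := ∑ j ∈ Finset.range B, v j
  have hv0 : ∀ j, 0 < v j := fun j ↦ by positivity
  have hV1 : 1 ≤ V := by
    have : v 0 ≤ V := Finset.single_le_sum (fun j _ ↦ (hv0 j).le) (Finset.mem_range.2 hB)
    simp [v] at this; exact this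
  have hV0 : 0 < V := by linarith
  have hV3 : V ≤ 3 := sum_range_inv_succ_sq_le B
  -- Jensen with weights `v_j / V`
  have hJ := Real.pow_arith_mean_le_arith_mean_pow (Finset.range B) (fun j ↦ v j / V) u
    (fun j _ ↦ (div_pos (hv0 j) hV0).le) (by rw [← Finset.sum_div]; exact div_self hV0.ne') (fun j _ ↦ hu j) k
  have hL : ∑ j ∈ Finset.range B, v j * u j = V * ∑ j ∈ Finset.range B, v j / V * u j := by
    rw [Finset.mul_sum]; refine Finset.sum_congr rfl fun j _ ↦ ?_; field_simp
  have hR : ∑ j ∈ Finset.range B, v j / V * u j ^ k = V⁻¹ * ∑ j ∈ Finset.range B, v j * u j ^ k := by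
    rw [Finset.mul_sum]; refine Finset.sum_congr rfl fun j _ ↦ ?_; field_simp
  have hS0 : 0 ≤ ∑ j ∈ Finset.range B, v j * u j ^ k :=
    Finset.sum_nonneg fun j _ ↦ mul_nonneg (hv0 j).le (pow_nonneg (hu j) _)
  show (∑ j ∈ Finset.range B, v j * u j) ^ k ≤ 3 ^ k * ∑ j ∈ Finset.range B, v j * u j ^ k
  rw [hL, mul_pow]
  calc V ^ k * (∑ j ∈ Finset.range B, v j / V * u j) ^ k
      ≤ V ^ k * (∑ j ∈ Finset.range B, v j / V * u j ^ k) :=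
        mul_le_mul_of_nonneg_left hJ (by positivity)
    _ = V ^ k * V⁻¹ * ∑ j ∈ Finset.range B, v j * u j ^ k := by rw [hR, mul_assoc]
    _ ≤ 3 ^ k * 1 * ∑ j ∈ Finset.range B, v j * u j ^ k := by
        refine mul_le_mul_of_nonneg_right ?_ hS0
        refine mul_le_mul (pow_le_pow_left₀ hV0.le hV3 _) (inv_le_one_of_one_le₀ hV1) (by positivity) (by positivity)
    _ = 3 ^ k * ∑ j ∈ Finset.range B, v j * u j ^ k := by rw [mul_one]

/-- **The key lemma** (moments of the smoothed local counts; RH): there are `C > 0` and `T₀` with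
`Σ_{a < N(T)} G(a)^k = Σ_{a < N(T)} (Σ_{n < N(T+3)} (1 + L|γ_n − γ_a|/2π)^{-3})^k ≤ C T log T`
for all `T ≥ T₀`. (Rudnick–Sarnak 1996, p. 303–304: the bound `O(TL)` for the majorant sums.)
[cite: RudnickSarnak1996, Thm. 3.2 (pp. 303–304)] -/
theorem exists_sum_locSum_pow_le (hRH : RiemannHypothesis) (k : ℕ) :
    ∃ C : ℝ, 0 < C ∧ ∃ T₀ : ℝ, 3 ≤ T₀ ∧ ∀ T : ℝ, T₀ ≤ T →
      ∑ a ∈ Finset.range (zetaZeroCount T), locSum T a ^ k ≤ C * T * Real.log T := by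
  obtain ⟨C, hC, T₀, hT₀3, hM⟩ := exists_sum_winCount_pow_le hRH k
  refine ⟨3 ^ (k + 1) * C, by positivity, T₀, hT₀3, fun T hT ↦ ?_⟩
  classical
  have hT3 : (3 : ℝ) ≤ T := hT₀3.trans hT
  have hT0 : (0 : ℝ) < T := by linarith
  have hL : 1 ≤ Real.log T := by
    rw [Real.le_log_iff_exp_le hT0]
    exact le_trans (le_of_lt (lt_trans Real.exp_one_lt_d9 (by norm_num))) hT3
  have hL0 : 0 < Real.log T := by linarith
  set R := Finset.range (zetaZeroCount (T + 3))
  set A := Finset.range (zetaZeroCount T)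
  -- a uniform bound `B` for the shells (for pivots `a < N(T)`)
  set B : ℕ := ⌊Real.log T * (T + 3) / (2 * π)⌋₊ + 1
  have hB : ∀ a ∈ A, ∀ n ∈ R, Real.log T * |zetaOrdinate n - zetaOrdinate a| / (2 * π) < B := by
    intro a ha n hn
    have hiff : ∀ {b : ℕ} {T' : ℝ}, b < zetaZeroCount T' → zetaOrdinate b ≤ T' := by
      intro b T' h; rw [riemann_von_mangoldt_holds.zetaOrdinate_le_iff]; omega
    have hn' : zetaOrdinate n ≤ T + 3 := hiff (Finset.mem_range.1 hn)
    have ha' : zetaOrdinate a ≤ T := hiff (Finset.mem_range.1 ha)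
    have hγn : 0 < zetaOrdinate n := zetaOrdinate_pos_holds n
    have hγa : 0 < zetaOrdinate a := zetaOrdinate_pos_holds a
    have habs : |zetaOrdinate n - zetaOrdinate a| ≤ T + 3 := by
      rw [abs_le]; constructor <;> linarith
    have h1 : Real.log T * |zetaOrdinate n - zetaOrdinate a| / (2 * π) ≤ Real.log T * (T + 3) / (2 * π) :=
      div_le_div_of_nonneg_right (mul_le_mul_of_nonneg_left habs hL0.le) (by positivity)
    have h2 := Nat.lt_floor_add_one (Real.log T * (T + 3) / (2 * π))
    calc Real.log T * |zetaOrdinate n - zetaOrdinate a| / (2 * π) < ⌊Real.log T * (T + 3) / (2 * π)⌋₊ + 1 :=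
          h1.trans_lt h2
      _ = B := by simp [B]
  -- the weights
  set v : ℕ → ℝ := fun j ↦ (((j : ℝ) + 1) ^ 2)⁻¹
  have hv0 : ∀ j, 0 < v j := fun j ↦ by positivity
  set W : ℕ → ℕ → ℝ := fun j a ↦ (winCount T (j + 1) a : ℝ)
  have hW0 : ∀ j a, 0 ≤ W j a := fun j a ↦ Nat.cast_nonneg _
  -- step 1: shells and Jensen, pointwise in `a`
  have hstep : ∀ a ∈ A, locSum T a ^ k ≤ 3 ^ k * ∑ j ∈ Finset.range B, v j * ((((j : ℝ) + 1) ^ k)⁻¹ * W j a ^ k) := by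
    intro a ha
    have h1 := locSum_le_sum_shells hL0 a (hB a ha)
    have h2 : ∑ j ∈ Finset.range B, (((j : ℝ) + 1) ^ 3)⁻¹ * (winCount T (j + 1) a : ℝ) =
        ∑ j ∈ Finset.range B, v j * ((((j : ℝ) + 1))⁻¹ * W j a) := by
      refine Finset.sum_congr rfl fun j _ ↦ ?_
      simp only [v, W]
      have : (0 : ℝ) < (j : ℝ) + 1 := by positivity
      field_simp
    rw [h2] at h1
    have h3 := pow_le_pow_left₀ (locSum_nonneg hL0.le a) h1 k
    refine h3.trans ((pow_sum_weights_le (by simp [B]) (fun j ↦ (((j : ℝ) + 1))⁻¹ * W j a) (fun j ↦ by positivity) k).trans ?_)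
    refine le_of_eq ?_
    congr 1
    refine Finset.sum_congr rfl fun j _ ↦ ?_
    rw [mul_pow, inv_pow]
  -- step 2: sum over `a`, swap, and use the moment bound
  have hmom : ∀ j, ∑ a ∈ A, W j a ^ k ≤ C * ((j : ℝ) + 1) ^ k * T * Real.log T :=
    fun j ↦ hM T hT (j + 1) (by linarith [(Nat.cast_nonneg j : (0 : ℝ) ≤ j)])
  calc ∑ a ∈ A, locSum T a ^ k
      ≤ ∑ a ∈ A, 3 ^ k * ∑ j ∈ Finset.range B, v j * ((((j : ℝ) + 1) ^ k)⁻¹ * W j a ^ k) :=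
        Finset.sum_le_sum hstep
    _ = 3 ^ k * ∑ j ∈ Finset.range B, v j * (((j : ℝ) + 1) ^ k)⁻¹ * ∑ a ∈ A, W j a ^ k := by
        rw [← Finset.mul_sum, Finset.sum_comm]
        congr 1
        refine Finset.sum_congr rfl fun j _ ↦ ?_
        rw [Finset.mul_sum]
        refine Finset.sum_congr rfl fun a _ ↦ ?_
        ring
    _ ≤ 3 ^ k * ∑ j ∈ Finset.range B, v j * (((j : ℝ) + 1) ^ k)⁻¹ * (C * ((j : ℝ) + 1) ^ k * T * Real.log T) := by
        refine mul_le_mul_of_nonneg_left (Finset.sum_le_sum fun j _ ↦ ?_) (by positivity)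
        exact mul_le_mul_of_nonneg_left (hmom j) (by positivity)
    _ = 3 ^ k * (C * T * Real.log T) * ∑ j ∈ Finset.range B, v j := by
        rw [Finset.mul_sum, Finset.mul_sum]
        refine Finset.sum_congr rfl fun j _ ↦ ?_
        have : (((j : ℝ) + 1) ^ k) ≠ 0 := by positivity
        field_simp
    _ ≤ 3 ^ k * (C * T * Real.log T) * 3 :=
        mul_le_mul_of_nonneg_left (sum_range_inv_succ_sq_le B) (by positivity)
    _ = 3 ^ (k + 1) * C * T * Real.log T := by rw [pow_succ]; ring

end Unsmooth

end RudnickSarnakN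

end Literature.NumberTheory.LFunctions

end
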